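import Literature.NumberTheory.Transcendental.SemialgebraicLineDeriv
import Literature.NumberTheory.Transcendental.DrinfeldAssociatorRegularisation
import Literature.NumberTheory.Transcendental.Associators
import Summits.KontsevichZagierPeriods.KontsevichZagierPeriods.Theses.FurushoPentagon

/-!
# `PentagonInKZ`, line `edge-normal-newton-leibniz`: corner engine — semialgebraicity of the dictionary

The integrands of the corner engine (proof of `cornerEngine_uniformlyNull`, crux
`FurushoPentagon.PentagonInKZ`, stmt-KontsevichZagierPeriods-11348) are built from coordinates,
rational constants and `ℚ`-semialgebraic role/weight functions by the field operations (Mathlib's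
total inverse, junk value `0⁻¹ = 0`, included) and by case distinctions on LETTERS (not on points).
This file records that every such integrand is `ℚ`-semialgebraic on any `ℚ`-semialgebraic set: the
letter densities `fd`, `gd`, the dilated cubical word integrands `qH`, `qV`, their explicit
derivatives `dqH`, `dqV`, the regularised word integrands `Ht`, `Vt` and the defect integrand `F`,
all given as HYPOTHESISED DICTIONARIES (functions with their defining equations, as in the engine's
registered statements), composed with arbitrary semialgebraic coordinate blocks and role functions.

References: [BochnakCosteRoy1998, Prop. 2.2.6] (semialgebraic functions form a ring closed under
the total inverse).
-/

noncomputable section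

open Set
open Literature.NumberTheory.Transcendental
open Literature.ModelTheory.ExponentialFields (IsSemialgebraic)

namespace Summit.KontsevichZagierPeriods.FurushoPentagon.PentagonInKZ

namespace CornerSemialg

variable {d : ℕ} {W : Set (Fin d → ℝ)}

/-- Quotients of real `ℚ`-semialgebraic functions are semialgebraic (total inverse, junk included).
[cite: BochnakCosteRoy1998, Prop. 2.2.6] -/
theorem sa_div {f g : (Fin d → ℝ) → ℝ} (hf : IsSemialgebraicFunOn ℚ W f)
    (hg : IsSemialgebraicFunOn ℚ W g) : IsSemialgebraicFunOn ℚ W fun z => f z / g z :=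
  (hf.fun_mul hg.fun_inv).congr fun z _ => by simp [div_eq_mul_inv]

/-- A case distinction on a decidable proposition NOT depending on the point preserves
semialgebraicity. [folklore] -/
theorem sa_ite {p : Prop} [Decidable p] {f g : (Fin d → ℝ) → ℝ} (hf : IsSemialgebraicFunOn ℚ W f)
    (hg : IsSemialgebraicFunOn ℚ W g) : IsSemialgebraicFunOn ℚ W fun z => if p then f z else g z := by
  by_cases hp : p
  · simpa [hp] using hf
  · simpa [hp] using hg

variable {m : ℕ} (cf : Fin (m + 2) → Fin 4 → ℚ)

/-- **The letter densities are semialgebraic** in semialgebraic arguments: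
`z ↦ fd k (T z) (Y z)`, `fd k t y = (b_k + d_k y)/(a_k + b_k t + c_k y + d_k t y)`.
[cite: BochnakCosteRoy1998, Prop. 2.2.6] -/
theorem sa_fd (fd : Fin (m + 2) → ℝ → ℝ → ℝ)
    (hfd : ∀ k t y, fd k t y = ((cf k 1 : ℝ) + (cf k 3 : ℝ) * y) /
      ((cf k 0 : ℝ) + (cf k 1 : ℝ) * t + (cf k 2 : ℝ) * y + (cf k 3 : ℝ) * t * y))
    (hW : IsSemialgebraic ℚ W) (k : Fin (m + 2)) {T Y : (Fin d → ℝ) → ℝ}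
    (hT : IsSemialgebraicFunOn ℚ W T) (hY : IsSemialgebraicFunOn ℚ W Y) :
    IsSemialgebraicFunOn ℚ W fun z => fd k (T z) (Y z) := by
  have hc := fun i => isSemialgebraicFunOn_const_ratCast hW (cf k i)
  refine (sa_div ((hc 1).fun_add ((hc 3).fun_mul hY))
    ((((hc 0).fun_add ((hc 1).fun_mul hT)).fun_add ((hc 2).fun_mul hY)).fun_add
      (((hc 3).fun_mul hT).fun_mul hY))).congr fun z _ => ?_
  rw [hfd]

/-- **The vertical letter densities are semialgebraic** in semialgebraic arguments.
[cite: BochnakCosteRoy1998, Prop. 2.2.6] -/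
theorem sa_gd (gd : Fin (m + 2) → ℝ → ℝ → ℝ)
    (hgd : ∀ k x s, gd k x s = ((cf k 2 : ℝ) + (cf k 3 : ℝ) * x) /
      ((cf k 0 : ℝ) + (cf k 1 : ℝ) * x + (cf k 2 : ℝ) * s + (cf k 3 : ℝ) * x * s))
    (hW : IsSemialgebraic ℚ W) (k : Fin (m + 2)) {X S : (Fin d → ℝ) → ℝ}
    (hX : IsSemialgebraicFunOn ℚ W X) (hS : IsSemialgebraicFunOn ℚ W S) :
    IsSemialgebraicFunOn ℚ W fun z => gd k (X z) (S z) := by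
  have hc := fun i => isSemialgebraicFunOn_const_ratCast hW (cf k i)
  refine (sa_div ((hc 2).fun_add ((hc 3).fun_mul hX))
    ((((hc 0).fun_add ((hc 1).fun_mul hX)).fun_add ((hc 2).fun_mul hS)).fun_add
      (((hc 3).fun_mul hX).fun_mul hS))).congr fun z _ => ?_
  rw [hgd]

/-- Partial products of semialgebraic coordinate blocks are semialgebraic. [folklore] -/
theorem sa_partialProd (hW : IsSemialgebraic ℚ W) {n : ℕ} {X : (Fin d → ℝ) → Fin n → ℝ}
    (hX : ∀ i, IsSemialgebraicFunOn ℚ W fun z => X z i) (s : Finset (Fin n)) :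
    IsSemialgebraicFunOn ℚ W fun z => ∏ j ∈ s, X z j :=
  IsSemialgebraicFunOn.fun_finsetProd s hW fun j _ => hX j

/-- **The dilated cubical word integrands are semialgebraic**: `z ↦ qH u (X z) (P z) (Q z)` for a
semialgebraic coordinate block `X` and semialgebraic role functions `P`, `Q` (total inverse on the
regularised letter, junk included). [cite: BochnakCosteRoy1998, Prop. 2.2.6] -/
theorem sa_qH (fd : Fin (m + 2) → ℝ → ℝ → ℝ)
    (hfd : ∀ k t y, fd k t y = ((cf k 1 : ℝ) + (cf k 3 : ℝ) * y) /
      ((cf k 0 : ℝ) + (cf k 1 : ℝ) * t + (cf k 2 : ℝ) * y + (cf k 3 : ℝ) * t * y))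
    (qH : ∀ {n : ℕ}, (Fin n → Fin (m + 2)) → (Fin n → ℝ) → ℝ → ℝ → ℝ)
    (hqH : ∀ {n : ℕ} (u : Fin n → Fin (m + 2)) (x : Fin n → ℝ) (ξ η : ℝ), qH u x ξ η =
      ∏ i, if u i = 0 then 1 / x i else (ξ * ∏ j ∈ Finset.univ.filter (fun j => j < i), x j) *
        fd (u i) (ξ * ∏ j ∈ Finset.univ.filter (fun j => j ≤ i), x j) η)
    (hW : IsSemialgebraic ℚ W) {n : ℕ} (u : Fin n → Fin (m + 2)) {X : (Fin d → ℝ) → Fin n → ℝ}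
    {P Q : (Fin d → ℝ) → ℝ} (hX : ∀ i, IsSemialgebraicFunOn ℚ W fun z => X z i)
    (hP : IsSemialgebraicFunOn ℚ W P) (hQ : IsSemialgebraicFunOn ℚ W Q) :
    IsSemialgebraicFunOn ℚ W fun z => qH u (X z) (P z) (Q z) := by
  have h1 := isSemialgebraicFunOn_const_ratCast hW 1
  have key : IsSemialgebraicFunOn ℚ W fun z => ∏ i : Fin n, (if u i = 0 then 1 / X z i else
      (P z * ∏ j ∈ Finset.univ.filter (fun j => j < i), X z j) *
        fd (u i) (P z * ∏ j ∈ Finset.univ.filter (fun j => j ≤ i), X z j) (Q z)) := by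
    refine IsSemialgebraicFunOn.fun_finsetProd _ hW fun i _ => sa_ite ?_ ?_
    · exact (sa_div h1 (hX i)).congr fun z _ => by push_cast; ring
    · exact (hP.fun_mul (sa_partialProd hW hX _)).fun_mul
        (sa_fd cf fd hfd hW (u i) (hP.fun_mul (sa_partialProd hW hX _)) hQ)
  exact key.congr fun z _ => by rw [hqH]

/-- **The vertical word integrands are semialgebraic**: `z ↦ qV v (Y z) (P z) (Q z)`.
[cite: BochnakCosteRoy1998, Prop. 2.2.6] -/
theorem sa_qV (gd : Fin (m + 2) → ℝ → ℝ → ℝ)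
    (hgd : ∀ k x s, gd k x s = ((cf k 2 : ℝ) + (cf k 3 : ℝ) * x) /
      ((cf k 0 : ℝ) + (cf k 1 : ℝ) * x + (cf k 2 : ℝ) * s + (cf k 3 : ℝ) * x * s))
    (qV : ∀ {n : ℕ}, (Fin n → Fin (m + 2)) → (Fin n → ℝ) → ℝ → ℝ → ℝ)
    (hqV : ∀ {n : ℕ} (v : Fin n → Fin (m + 2)) (y : Fin n → ℝ) (ξ η : ℝ), qV v y ξ η =
      ∏ i, if v i = 1 then 1 / y i else (η * ∏ j ∈ Finset.univ.filter (fun j => j < i), y j) *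
        gd (v i) ξ (η * ∏ j ∈ Finset.univ.filter (fun j => j ≤ i), y j))
    (hW : IsSemialgebraic ℚ W) {n : ℕ} (v : Fin n → Fin (m + 2)) {Y : (Fin d → ℝ) → Fin n → ℝ}
    {P Q : (Fin d → ℝ) → ℝ} (hY : ∀ i, IsSemialgebraicFunOn ℚ W fun z => Y z i)
    (hP : IsSemialgebraicFunOn ℚ W P) (hQ : IsSemialgebraicFunOn ℚ W Q) :
    IsSemialgebraicFunOn ℚ W fun z => qV v (Y z) (P z) (Q z) := by
  have h1 := isSemialgebraicFunOn_const_ratCast hW 1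
  have key : IsSemialgebraicFunOn ℚ W fun z => ∏ i : Fin n, (if v i = 1 then 1 / Y z i else
      (Q z * ∏ j ∈ Finset.univ.filter (fun j => j < i), Y z j) *
        gd (v i) (P z) (Q z * ∏ j ∈ Finset.univ.filter (fun j => j ≤ i), Y z j)) := by
    refine IsSemialgebraicFunOn.fun_finsetProd _ hW fun i _ => sa_ite ?_ ?_
    · exact (sa_div h1 (hY i)).congr fun z _ => by push_cast; ring
    · exact (hQ.fun_mul (sa_partialProd hW hY _)).fun_mul
        (sa_gd cf gd hgd hW (v i) hP (hQ.fun_mul (sa_partialProd hW hY _)))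
  exact key.congr fun z _ => by rw [hqV]

/-- **The regularised horizontal word integrands are semialgebraic**: `z ↦ Ht U (X z) (P z) (Q z)`
(finite `ℚ`-combinations of the `qH u`). [cite: BochnakCosteRoy1998, Prop. 2.2.6] -/
theorem sa_Ht (fd : Fin (m + 2) → ℝ → ℝ → ℝ)
    (hfd : ∀ k t y, fd k t y = ((cf k 1 : ℝ) + (cf k 3 : ℝ) * y) /
      ((cf k 0 : ℝ) + (cf k 1 : ℝ) * t + (cf k 2 : ℝ) * y + (cf k 3 : ℝ) * t * y))
    (qH : ∀ {n : ℕ}, (Fin n → Fin (m + 2)) → (Fin n → ℝ) → ℝ → ℝ → ℝ)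
    (hqH : ∀ {n : ℕ} (u : Fin n → Fin (m + 2)) (x : Fin n → ℝ) (ξ η : ℝ), qH u x ξ η =
      ∏ i, if u i = 0 then 1 / x i else (ξ * ∏ j ∈ Finset.univ.filter (fun j => j < i), x j) *
        fd (u i) (ξ * ∏ j ∈ Finset.univ.filter (fun j => j ≤ i), x j) η)
    (Ht : ∀ {n : ℕ}, (Fin n → Fin (m + 2)) → (Fin n → ℝ) → ℝ → ℝ → ℝ)
    (hHt : ∀ {n : ℕ} (U : Fin n → Fin (m + 2)) (x : Fin n → ℝ) (ξ η : ℝ), Ht U x ξ η =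
      ∑ u : Fin n → Fin (m + 2), (Shuffle.regEnd (0 : Fin (m + 2)) (List.ofFn U) (List.ofFn u) : ℝ) *
        qH u x ξ η)
    (hW : IsSemialgebraic ℚ W) {n : ℕ} (U : Fin n → Fin (m + 2)) {X : (Fin d → ℝ) → Fin n → ℝ}
    {P Q : (Fin d → ℝ) → ℝ} (hX : ∀ i, IsSemialgebraicFunOn ℚ W fun z => X z i)
    (hP : IsSemialgebraicFunOn ℚ W P) (hQ : IsSemialgebraicFunOn ℚ W Q) :
    IsSemialgebraicFunOn ℚ W fun z => Ht U (X z) (P z) (Q z) := by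
  have key : IsSemialgebraicFunOn ℚ W fun z => ∑ u : Fin n → Fin (m + 2),
      (Shuffle.regEnd (0 : Fin (m + 2)) (List.ofFn U) (List.ofFn u) : ℝ) * qH u (X z) (P z) (Q z) :=
    IsSemialgebraicFunOn.fun_finsetSum _ hW fun u _ =>
      (isSemialgebraicFunOn_const_ratCast hW _).fun_mul (sa_qH cf fd hfd qH hqH hW u hX hP hQ)
  exact key.congr fun z _ => by rw [hHt]

/-- **The regularised vertical word integrands are semialgebraic**: `z ↦ Vt V (Y z) (P z) (Q z)`.
[cite: BochnakCosteRoy1998, Prop. 2.2.6] -/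
theorem sa_Vt (gd : Fin (m + 2) → ℝ → ℝ → ℝ)
    (hgd : ∀ k x s, gd k x s = ((cf k 2 : ℝ) + (cf k 3 : ℝ) * x) /
      ((cf k 0 : ℝ) + (cf k 1 : ℝ) * x + (cf k 2 : ℝ) * s + (cf k 3 : ℝ) * x * s))
    (qV : ∀ {n : ℕ}, (Fin n → Fin (m + 2)) → (Fin n → ℝ) → ℝ → ℝ → ℝ)
    (hqV : ∀ {n : ℕ} (v : Fin n → Fin (m + 2)) (y : Fin n → ℝ) (ξ η : ℝ), qV v y ξ η =
      ∏ i, if v i = 1 then 1 / y i else (η * ∏ j ∈ Finset.univ.filter (fun j => j < i), y j) *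
        gd (v i) ξ (η * ∏ j ∈ Finset.univ.filter (fun j => j ≤ i), y j))
    (Vt : ∀ {n : ℕ}, (Fin n → Fin (m + 2)) → (Fin n → ℝ) → ℝ → ℝ → ℝ)
    (hVt : ∀ {n : ℕ} (V : Fin n → Fin (m + 2)) (y : Fin n → ℝ) (ξ η : ℝ), Vt V y ξ η =
      ∑ v : Fin n → Fin (m + 2), (Shuffle.regEnd (1 : Fin (m + 2)) (List.ofFn V) (List.ofFn v) : ℝ) *
        qV v y ξ η)
    (hW : IsSemialgebraic ℚ W) {n : ℕ} (V : Fin n → Fin (m + 2)) {Y : (Fin d → ℝ) → Fin n → ℝ}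
    {P Q : (Fin d → ℝ) → ℝ} (hY : ∀ i, IsSemialgebraicFunOn ℚ W fun z => Y z i)
    (hP : IsSemialgebraicFunOn ℚ W P) (hQ : IsSemialgebraicFunOn ℚ W Q) :
    IsSemialgebraicFunOn ℚ W fun z => Vt V (Y z) (P z) (Q z) := by
  have key : IsSemialgebraicFunOn ℚ W fun z => ∑ v : Fin n → Fin (m + 2),
      (Shuffle.regEnd (1 : Fin (m + 2)) (List.ofFn V) (List.ofFn v) : ℝ) * qV v (Y z) (P z) (Q z) :=
    IsSemialgebraicFunOn.fun_finsetSum _ hW fun v _ =>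
      (isSemialgebraicFunOn_const_ratCast hW _).fun_mul (sa_qV cf gd hgd qV hqV hW v hY hP hQ)
  exact key.congr fun z _ => by rw [hVt]

/-- Coordinates of a point are semialgebraic functions (restated for the engine's blocks).
[cite: BochnakCosteRoy1998, §2.2] -/
theorem sa_coord (hW : IsSemialgebraic ℚ W) (i : Fin d) : IsSemialgebraicFunOn ℚ W fun z => z i :=
  (isSemialgebraicFunOn_aeval hW (MvPolynomial.X i : MvPolynomial (Fin d) ℚ)).congr fun z _ => by simp

end CornerSemialg

/-- **Hook `cornerSemialg_qH`** (registered form of `CornerSemialg.sa_qH`): the dilated cubical word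
integrands composed with semialgebraic blocks and role functions are `ℚ`-semialgebraic.
[cite: BochnakCosteRoy1998, Prop. 2.2.6] -/
theorem cornerSemialg_qH : ∀ (d : ℕ) (W : Set (Fin d → ℝ)) (m : ℕ) (cf : Fin (m + 2) → Fin 4 → ℚ) (fd : Fin (m + 2) → ℝ → ℝ → ℝ), (∀ k t y, fd k t y = ((cf k 1 : ℝ) + (cf k 3 : ℝ) * y) / ((cf k 0 : ℝ) + (cf k 1 : ℝ) * t + (cf k 2 : ℝ) * y + (cf k 3 : ℝ) * t * y)) → ∀ (qH : ∀ {n : ℕ}, (Fin n → Fin (m + 2)) → (Fin n → ℝ) → ℝ → ℝ → ℝ), (∀ {n : ℕ} (u : Fin n → Fin (m + 2)) (x : Fin n → ℝ) (ξ η : ℝ), qH u x ξ η = ∏ i, if u i = 0 then 1 / x i else (ξ * ∏ j ∈ Finset.univ.filter (fun j => j < i), x j) * fd (u i) (ξ * ∏ j ∈ Finset.univ.filter (fun j => j ≤ i), x j) η) → Literature.ModelTheory.ExponentialFields.IsSemialgebraic ℚ W → ∀ {n : ℕ} (u : Fin n → Fin (m + 2)) (X : (Fin d → ℝ) → Fin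 n → ℝ) (P Q : (Fin d → ℝ) → ℝ), (∀ i, IsSemialgebraicFunOn ℚ W fun z => X z i) → IsSemialgebraicFunOn ℚ W P → IsSemialgebraicFunOn ℚ W Q → IsSemialgebraicFunOn ℚ W fun z => qH u (X z) (P z) (Q z) :=
  fun _ _ _ cf fd hfd qH hqH hW _ u _ _ _ hX hP hQ => CornerSemialg.sa_qH cf fd hfd qH hqH hW u hX hP hQ

end Summit.KontsevichZagierPeriods.FurushoPentagon.PentagonInKZ
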